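import Literature.MathematicalPhysics.QuantumFieldTheory.Balaban1983to89.Node00.Record12BgRowCoClassGaugeRGuardedBRowAllTorus
import Literature.MathematicalPhysics.QuantumFieldTheory.Balaban1983to89.Node00.LargeFieldBackgroundCoPOfRecordB
import Summits.QuantumFields.YangMills.Theorems.BalabanUVNodesN07Thm1Top7FromProp8GuardedB
import Literature.MathematicalPhysics.QuantumFieldTheory.Balaban1983to89.Node00.Record13SepCoPInhabitedOfThm1CCMGaugeR
import Literature.MathematicalPhysics.QuantumFieldTheory.Balaban1983to89.Node00.Record13SepCoPRInhabitedOfSepCoP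
import Literature.MathematicalPhysics.QuantumFieldTheory.Balaban1983to89.Node00.Record13SepCoPLiveSelector
import Literature.MathematicalPhysics.QuantumFieldTheory.Balaban1983to89.Node00.Record13SignFreeComparabilityOfBetaBox
import Summits.QuantumFields.YangMills.Theorems.BalabanUVNodesN26AtRecord13BetaBoxOfDriftAtSlope

/-!
# K0⁷ — THE ALL-TORUS K0 BODY AT `θ₁₅ᶜᶜᴹ(j; γ)` AND THE (j, c)-GENERIC STUB COMPOSITION, RE-KEYED ON THE FLOOR-CARRYING (8)-SENTENCE
# `VariationalThm1RegSepCoP7MR F N c B₃ a₀ a₁` (V20 option R: stub 1 `∃ c B₃ a₀ a₁, … ∧ Prop8RegSepTopStepR F 2 suppDom c B₃ a₀ a₁`)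

SIBLING MODULE (director-ym №365, R558 FINAL «RENAME-AND-REDIRECT»): this is the NEW module `K0AllTorusOfStepTokensRFloorB` (namespace `Summit.QuantumFields.YangMills.Theorems.K0AllTorusOfStepTokensRFloorB`), carrying the
Stage-2 re-keyed texts of `K0AllTorusOfStepTokensRFloor` under the SAME short declaration names (every FQN new ⇒ `theorems.append-only` untouched); the old module `K0AllTorusOfStepTokensRFloor` is NOT edited and becomes
RESIDUE after the seam (R556 attic later); the old module's §5 (two (b)-currency displays) is not restated (see below).

STAGE-2 RE-KEY (same seat, generation 9, TRAIN-K0 row K0-T2 file 5∕6; director-ym №343 (D5) ∕ №346 ∕ №354; k0-s1-w1 g9 MANIFEST): (E1) Stage-2 coherence re-key to print's (2.3)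
datum (FLAG №16 ∕ LOCATE-HSEAM 5d3298b8d191f169); the (b)-keyed text survives in git history.  §1–§4: every displayed [15] token is now the GUARDED `(bd, Dat)` ᴮ token at the FLOOR guard
`floorGuard F c` (print's «R₁M₁ sufficiently big», p.304 lines 1–2), print's bond datum `lamDatum F` ([14] (2.3): `lamBondsSeq Ω k`) and a (7)-data predicate `Dat : TopData F N` kept a
PARAMETER with the pointwise transfer `hDat` from the support's displayed `Sect2.DataSmall7PTop` at torus-compatible prefixes (k0-s1-w1's ZBLam convention VERBATIM; at
`Dat := dataSmall7PTopOf F N` it is `fun … h => h`, at print's `dataSmall7LamTopOf F N` it is k0-s1-w1's `hDat_dataSmall7LamTopOf` — the V23 currency): (8) `VariationalThm1RegSepCoP7MGB F N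
(floorGuard F c) (lamDatum F) Dat B₃ a₀ a₁`, (9) `VariationalThm1GaugeRegSepCoP7MGB F N M (floorGuard F c) (lamDatum F) Dat …` ∕ `Gauge9RegSepTopStepGB F 2 suppDom (L^j) (floorGuard F c) (lamDatum F) Dat …`,
stub 1ᴿ `∃ (c : ℕ) (B₃ a₀ a₁ : ℝ), … ∧ Prop8RegSepTopStepGB F 2 suppDom (floorGuard F c) (lamDatum F) (DatF F) B₃ a₀ a₁`.  §1 is now ONE instantiation of k0-s1-w1's background-generic
all-torus lift `Stage13Params.bgAtDatumBg_of_thm1RegSepCoP7MGB_of_thm1GaugeGB_allTorus` (`Record12BgRowCoClassGaugeRGuardedBRowAllTorus`) at `Ubg := UbgMSCoPOfRecordB` (node00-def-R's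
Λ-minimiser at print's datum, `LargeFieldBackgroundCoPOfRecordB`), `hbg := ubgMSCoPOfRecordB_dichotomy`, `hAdm := hc`; §2 reads the Stage-2 seam by `UbgOfRecord₁₃CoP_succ`; (8) from the
step by 53′ `variationalThm1RegSepCoP7MGB_of_prop8TopStepGB_lamDatum`, floor raised by `.of_imp (floorGuard_imp_of_le …)`; (9) by S1b-2's `variationalThm1GaugeRegSepCoP7MGB_of_gauge9TopStepGB`.
SEAM DISPLAYED (director-ym №368 (2), k0-s1-w1's ZBLam pattern of record): §2–§4 carry ONE hypothesis `hseam` = the Stage-2 seam equation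
`UbgOfRecord₁₃CoP F N θ p (n+1) s W = UbgMSCoPOfRecordB …` (pre-seam NOT provable and NOT claimed; post-seam it IS `UbgOfRecord₁₃CoP_succ`, one `rfl`-line, or k0-s1-w1's `…ZBLamSeam.hseam_holds`) —
so this module elaborates on BOTH sides of the seam and files outside the campaign; `clausesH_of_absBox` is a PRIVATE verbatim re-home (№366 R2) so nothing of the residue road is imported.
WHY `Dat` GENERIC: at `Dat := dataSmall7PTopOf F 2` the closers of §2–§3 would RESTATE chain B's re-keyed `…CCMWGaugeRAllTorus` §3–§4 byte for byte (one floor currency under ᴮ) — the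
parameter keeps this file the R∕floor road's V23-currency edition instead.  §5 of the old module (the two (b) ⟹ (b) direction displays `prop8StepCoPR_of_prop8StepCoP` ∕ `absBetaBoxAtGen_of_absBetaBoxAtGenR`) is NOT re-declared here:
it stays, byte-identical and true, in the residue module for its (b)-currency importers (`dedup.landed`).  Declaration NAMES unchanged; binder ORDER unchanged but for the new `{Dat}`∕`{DatF}` (implicit) and
`hDat` (explicit, right after the token hypotheses).  Re-keying bookkeeping only — nothing of Bałaban asserted.  [14] = [Balaban1984PropagatorsII].

Cell `pub-ymgap`, seat `pub-ymgap-k0-s1-w3` generation 7 (K0⁷ `stmt-QuantumFields-20541`, V19 stub 1 `stub_prop8StepCoP13` helper lane;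
`--kind proof --supports stmt-QuantumFields-20541 --as helper`).  NEW leaf, theorems only (0 `def`, 0 `sorry`); nothing in the tree is modified.

WHY.  dag-n07-e's LOCATED-STUB1-FLOOR (2026-08-28): the stub-1 chain of [15] Sect. F at NODE 00's objects is floor-free in `ν.M₁` while every per-datum supplier of the
S6 head carries print's floor «R₁M₁ sufficiently big» ([15] p. 304 lines 1–2); the repair of record (plan (R-b), lane owner's `V20-STUB1-TEXT-PROPOSAL.md`) re-texts stub 1
with the floor `c ≤ ν.M₁` ∃-bound OUTERMOST — option R: `∃ (c : ℕ) (B₃ a₀ a₁ : ℝ), 2L² ≤ B₃ ∧ 0 < a₀ ∧ 0 < a₁ ∧ Prop8RegSepTopStepR F 2 suppDom c B₃ a₀ a₁` (module 46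
`Node00/CriticalOnFibreTopFloor`) — and gives stub 3ᴬ′ the floor-carrying first antecedent `VariationalThm1RegSepCoP7MGB F 2 (floorGuard F c) (lamDatum F) Dat B₃ a₀ a₁` at the SAME `c` as its (9)-antecedent.
Every R-letter the K0 body needs is in the tree (n07-e modules 46∕48∕49∕50, the Summits (8)-bridge `…N07Thm1Top7FromProp8Floor`); the ONE untyped link was the K0-BODY SIDE:
dag-n21-c's all-torus closer chain (`Node00/Record13SepCoPInhabitedOfThm1CCMWGaugeRAllTorus`, p575996) and PART 1 (`…K0GenericCubeOfStepTokensR`, p589753) read the floor-FREE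
`h15 : VariationalThm1RegSepCoP7M`.  THIS FILE is that chain with `h15 ↦ h15R : VariationalThm1RegSepCoP7MR F N c B₃ a₀ a₁` at the floor `c` those theorems ALREADY carry for the
gauge sentence (`hc : c ≤ θ.ν.M₁`, resp. `c ≤ L^j = ν.M₁(θ₁₅ᶜᶜᴹ(j))`): statements otherwise VERBATIM, proofs the originals' with n07-e's module 50
`bgRowAtDatumCoP_of_thm1RegSepCoP7MR_of_thm1GaugeR` at the one application.  §4 is PART 1 §2–§4 re-keyed the same way (stub-level composition with a GENERIC R-supplier; NODE O's
jets-free socket on the R text); §5 displays the direction of the re-text (V19 stub 1 ⇒ V20-R stub 1; V20-R 3ᴬ′ ⇒ V19 3ᴬ′ — the R text of stub 3 is the STRONGER one).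
PART 2-R (stub 2′ fills the R-supplier slot; the three-stub composition `record13SepCoPHBody_of_stubs1R_2P_3A'R`) is the sibling file `…K0PrintCubeOfStepTokensRFloor`.

CONTENTS.  §1 ★ `bgAtDatumCoP_of_thm1RegSepCoP7MR_of_thm1GaugeR_allTorus` (p575996 §2 at `h15R`).  §2 ★★ `bgSepCoPAt_theta13OfThm1CCMW_of_thm1RegSepCoP7MR_of_thm1GaugeR_of_hcomp_allTorus`.
§3 closers `exists_k0SepCoP{,H}_thm1CCMW_of_thm1RegSepCoP7MR_of_thm1GaugeR_of_hcomp_allTorus`, `exists_k0SepCoPH_thm1CCMW_of_thm1RegSepCoP7MR_of_gauge9TopStepR_of_hcomp_allTorus`.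
§4 ★ `exists_k0H_of_thm1CoP7MR_of_gauge9R_of_absBox`, ★★ `record13SepCoPHBody_of_stub1R_of_gauge9SupplierR_of_absBetaBoxAtR`, `absBetaBoxAtR_of_jetsFreePairAtR`.
§5 `prop8StepCoPR_of_prop8StepCoP`, `absBetaBoxAtGen_of_absBetaBoxAtGenR`.

HONEST FRAMING: count-neutral kernel re-keying BY NAME; every [15]∕[6]∕[I] sentence is a HYPOTHESIS (a `Prop`, never asserted, inhabited nowhere here); the compositions are
CONDITIONAL on the stub texts; `stub_prop8StepCoP13` ∕ K0⁷ ∕ K1⁹ NOT closed; N07 NOT discharged; counts unmoved (typed 28∕28 · discharged 5∕27); the route closes only the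
conditional finite-𝕋⁴ rung `BalabanLadder.UV` — the YM mass gap (Clay) is NOT proved by any of this; nothing continuum ∕ ℝ⁴ ∕ OS.  No `sorry`, `def`, `instance`, `notation`.
[15] = Bałaban, CMP 102 (1985) 277–309 [Balaban1985Variational]; [6] = CMP 99 (1985) 75 [Balaban1985RegularSpaces]; [III] = CMP 119 (1988) 243 [Balaban1988Convergent];
[I] = CMP 109 (1987) 249 [Balaban1987RG1]; [II] = CMP 122 (1989) 355 [Balaban1989LargeFieldII]; [RG2] = CMP 116 (1988) 1 [Balaban1988RG2Cluster].
-/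

noncomputable section

open MeasureTheory
open scoped Matrix.Norms.L2Operator

namespace Summit.QuantumFields.YangMills.Theorems.K0AllTorusOfStepTokensRFloorB

open Literature.MathematicalPhysics.QuantumFieldTheory.Balaban1983to89
open Literature.MathematicalPhysics.QuantumFieldTheory.Balaban1983to89.Node00
open Literature.MathematicalPhysics.QuantumFieldTheory.Balaban1983to89.T4Continuum
open Literature.MathematicalPhysics.QuantumFieldTheory.Balaban1983to89.FlowStep
open Literature.MathematicalPhysics.QuantumFieldTheory.Balaban1983to89.FlowStepRuns
open Literature.MathematicalPhysics.QuantumFieldTheory.Balaban1983to89.B14.Eq218Concrete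
open Literature.MathematicalPhysics.QuantumFieldTheory.Balaban1983to89.B15DeterminingSets
open Literature.MathematicalPhysics.QuantumFieldTheory.Balaban1983to89.B12RegularSpaces111
open Literature.MathematicalPhysics.QuantumFieldTheory.Balaban1983to89.B14RegularSpaces234
open Literature.MathematicalPhysics.QuantumFieldTheory.Balaban1983to89.Beta.Drift (OneLoopDrift)
open Summit.QuantumFields.BalabanUV.Gaps.BetaContFromD4Chain (AtSlopeCont)
open Summit.QuantumFields.YangMills.BalabanUVNodes.N07Thm1Top7FromProp8GuardedB (variationalThm1RegSepCoP7MGB_of_prop8TopStepGB_lamDatum)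
open Summit.QuantumFields.YangMills.Theorems.BalabanUVNodesN26AtRecord13BetaBoxOfDriftAtSlope (exists_betaBox_betaOfRecord₁₃_of_jetsFreePair)

/-! ## §1  ★ B′'s Stage-13 reduction on every family (p575996 §2), keyed on the FLOOR-CARRYING (8) `CoP` sentence -/

section LiftGaugeRAllTorusFloor

variable {F : T4Family} {N : ℕ} [NeZero N]

/-- **★ ROW P11's BODY AT `UbgMSCoPOfRecord … n s 𝐖` AT THE STAGE-13 RECORD FROM THE FLOOR-CARRYING (8) `CoP` SENTENCE `VariationalThm1RegSepCoP7MR … c …` AND THE R GAUGE `CoP`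
SENTENCE AT CUBE LETTER `θ.τ9.M` AND FLOOR `c`, FOR A PARAMETER MEETING THE FLOOR (`hc : c ≤ θ.ν.M₁`), ON EVERY FAMILY** — dag-n21-c's
`Stage13Params.bgAtDatumCoP_of_thm1RegSepCoP7M_of_thm1GaugeR_allTorus` (p575996 §2: the non-wrapping binder `hsN` DERIVED from `PartCompat₁₃` and (C1) via `hsN_of_partCompat₁₃`,
row `hM`'s letter `∃ a, θ.τ9.M = F.L ^ a` in its place) with `h15` FLOOR-CARRYING at the floor the lemma already carries for `h15G` — the one application re-sourced to n07-e's module 50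
`bgRowAtDatumCoP_of_thm1RegSepCoP7MR_of_thm1GaugeR`; every other letter and the proof VERBATIM.  A REDUCTION: both sentences are hypotheses, never asserted.
[cite: Balaban1985Variational, (6)–(7) p.278, Thm 1 (8)–(9) p.279, (152) p.301, Prop. 8 p.304, p.304 lines 1–2; Balaban1985RegularSpaces, (1.3)–(1.9) p.77, Prop. 6 p.99; Balaban1988Convergent, Thm 1 p.262, (2.1) p.254, (2.4)–(2.8) pp.255–256, (2.12)–(2.13) pp.256–257, p.257, (2.27)–(2.28) p.259, (2.34)–(2.41) p.261; Balaban1987RG1, (1.11)–(1.12) p.262] -/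
theorem bgAtDatumCoP_of_thm1RegSepCoP7MR_of_thm1GaugeR_allTorus (θ : Stage13Params F N) (hθ : θ.Admissible F N) (hRz : θ.Rz = RzOfRecord F N)
    {c : ℕ} {Dat : TopData F N} {B₃ B₃' a₀ a₁ : ℝ} (hM : 0 < θ.τ9.M) (hc : c ≤ θ.ν.M₁)
    (h15 : VariationalThm1RegSepCoP7MGB F N (floorGuard F c) (lamDatum F) Dat B₃ a₀ a₁)
    (h15G : VariationalThm1GaugeRegSepCoP7MGB F N θ.τ9.M (floorGuard F c) (lamDatum F) Dat B₃ B₃' a₀ a₁)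
    (hnum : ∀ (p : B12.RunParams) (n : ℕ), n ≤ p.K → Step.InInterval θ.γ n (gOfRecord₁₃ F N θ p) → ∀ m, m ≤ n →
      0 < θ.s2.cR * epsOfRecord θ.ν (gOfRecord₁₃ F N θ p) m ∧ θ.s2.cR * epsOfRecord θ.ν (gOfRecord₁₃ F N θ p) m ≤ a₁ ∧ B₃ * (θ.s2.cR * epsOfRecord θ.ν (gOfRecord₁₃ F N θ p) m) ≤ θ.ν.εreg)
    (ha₀ : θ.ν.εreg ≤ a₀)
    (hcomp : ∀ (p : B12.RunParams) (n : ℕ), n ≤ p.K → Step.InInterval θ.γ n (gOfRecord₁₃ F N θ p) → ∀ m, m < n →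
      θ.s2.cR * epsOfRecord θ.ν (gOfRecord₁₃ F N θ p) m ≤ 2 * (θ.s2.cR * epsOfRecord θ.ν (gOfRecord₁₃ F N θ p) (m + 1)))
    (hcomp' : ∀ (p : B12.RunParams) (n : ℕ), n ≤ p.K → Step.InInterval θ.γ n (gOfRecord₁₃ F N θ p) → ∀ m, m < n →
      θ.s2.cR * epsOfRecord θ.ν (gOfRecord₁₃ F N θ p) (m + 1) ≤ 2 * (θ.s2.cR * epsOfRecord θ.ν (gOfRecord₁₃ F N θ p) m))
    (hBα : ∀ (p : B12.RunParams) (n : ℕ), n ≤ p.K → Step.InInterval θ.γ n (gOfRecord₁₃ F N θ p) → ∀ m, 1 ≤ m → m ≤ n →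
      B₃ * (θ.s2.cR * epsOfRecord θ.ν (gOfRecord₁₃ F N θ p) m) ≤ (1 - θ.s2.βc) * (lfOfRecord₁₂ F N θ.toStage12Params).alpha0 (gOfRecord₁₃ F N θ p m))
    (htI : ∀ (p : B12.RunParams) (n : ℕ), n ≤ p.K → Step.InInterval θ.γ n (gOfRecord₁₃ F N θ p) → ∀ m, 1 ≤ m → m ≤ n →
      B₃' * (θ.s2.cR * epsOfRecord θ.ν (gOfRecord₁₃ F N θ p) m) ≤ θ.s2.cB * (lfOfRecord₁₂ F N θ.toStage12Params).alpha0 (gOfRecord₁₃ F N θ p m))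
    (htMS : ∀ (p : B12.RunParams) (n : ℕ), n ≤ p.K → Step.InInterval θ.γ n (gOfRecord₁₃ F N θ p) → ∀ m, 1 ≤ m → m ≤ n →
      B₃' * (θ.s2.cR * epsOfRecord θ.ν (gOfRecord₁₃ F N θ p) m) ≤ θ.s2.B * θ.s2.C * θ.s2.Mr * (lfOfRecord₁₂ F N θ.toStage12Params).alpha0 (gOfRecord₁₃ F N θ p m))
    (hC1 : ∀ (p : B12.RunParams) (n : ℕ), n ≤ p.K → Step.InInterval θ.γ n (gOfRecord₁₃ F N θ p) → ∀ j, 1 ≤ j → j ≤ n →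
      ∃ t : ℕ, 0 < t ∧ RkOfRecord (F.P p.K).L θ.ν.r (gOfRecord₁₃ F N θ p j) = (F.P p.K).L * t)
    (hMa : ∃ a : ℕ, θ.τ9.M = F.L ^ a) :
    ∀ (p : B12.RunParams) (n : ℕ), n ≤ p.K → Step.InInterval θ.γ n (gOfRecord₁₃ F N θ p) → PartCompat₁₃ F N θ p n →
      ∀ s : SeqOfRecord F θ.ν θ.τ9.M (gOfRecord₁₃ F N θ p) p.K n, Sect2.SeqSeparated θ.ν.M₁ s → 0 < θ.ν.M₁ → ∀ W : MSField (F.P p.K) (SU N),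
      Dat p.K s.Ω (suppDomOfRecord F θ.ν p.K s.Ω) n (fun j => θ.s2.cR * epsOfRecord θ.ν (gOfRecord₁₃ F N θ p) j) W →
      ∀ j, 1 ≤ j → j ≤ n → ∀ X : (Sect2.domSys (F.P p.K) θ.τ9.M j).Dom,
      (Sect2.domSites (F.P p.K) θ.τ9.M j X ⊆ s.Λ j →
        Sect2.ofBackgroundC (settingOfRecord₁₃ F N θ p).ι (UbgMSCoPOfRecordB F N θ.ν θ.τ9.M (gOfRecord₁₃ F N θ p) p.K n s W) ∈
          Sect2.spaceI (settingOfRecord₁₃ F N θ p) (θ.Rz p.K) θ.τ9.M j (Sect2.domSites (F.P p.K) θ.τ9.M j X)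
            ((settingOfRecord₁₃ F N θ p).lf.alpha0 ((settingOfRecord₁₃ F N θ p).flow.g j)) ((settingOfRecord₁₃ F N θ p).lf.alpha1 ((settingOfRecord₁₃ F N θ p).flow.g j))) ∧
      (Sect2.admB (F.P p.K) θ.ν θ.τ9.M (gOfRecord₁₃ F N θ p) s.Ω s.Λ j (Sect2.domSites (F.P p.K) θ.τ9.M j X) = true →
        Sect2.ofBackgroundC (settingOfRecord₁₃ F N θ p).ι (UbgMSCoPOfRecordB F N θ.ν θ.τ9.M (gOfRecord₁₃ F N θ p) p.K n s W) ∈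
          Sect2.spaceMS (settingOfRecord₁₃ F N θ p) (θ.Rz p.K) θ.τ9.M j (Sect2.domSites (F.P p.K) θ.τ9.M j X) s.Ω) :=
  θ.bgAtDatumBg_of_thm1RegSepCoP7MGB_of_thm1GaugeGB_allTorus hθ hRz hM h15 h15G
    (fun p n s W => UbgMSCoPOfRecordB F N θ.ν θ.τ9.M (gOfRecord₁₃ F N θ p) p.K n s W)
    (fun p n s W => ubgMSCoPOfRecordB_dichotomy θ.ν θ.τ9.M (gOfRecord₁₃ F N θ p) p.K n s W)
    hnum ha₀ hcomp hcomp' hBα htI htMS hC1 hMa (fun _ _ _ _ _ _ _ => hc)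

end LiftGaugeRAllTorusFloor

/-! ## §2  ★★ At `θ₁₅ᶜᶜᴹ(j; γ)`: the (7)-guarded separated row P11 at the Co carrier from the floor-carrying (8), the R gauge sentence and (hcomp) ∧ (hcompRev), on EVERY family -/

section AtWitnessFloor

variable {F : T4Family} {N : ℕ} [NeZero N] {j c : ℕ} {Dat : TopData F N} {γ ε₀ ε₂₉ B₃ B₃' a₀ a₁ : ℝ}

/-- **★★ THE (7)-GUARDED SEPARATED ROW P11 AT THE Co CARRIER AT `θ₁₅ᶜᶜᴹ(j; γ)` FROM `0 < γ ≤ ½`, THE FLOOR-CARRYING (8) AT FLOOR `c ≤ L^j`, THE R GAUGE SENTENCE AT `(L^j, c)` AND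
(hcomp) ∧ (hcompRev), ON EVERY FAMILY** — dag-n21-c's `bgSepCoPAt_theta13OfThm1CCMW_of_thm1GaugeR_of_hcomp_allTorus` (p575996 §3) with `h15` floor-carrying at the floor `c` its
`hc : c ≤ F.L ^ j` already binds (the witness meets it: `ν.M₁(θ₁₅ᶜᶜᴹ(j; γ)) = L^j`, A2ʷ `theta13OfThm1CCMW_M₁`); statement otherwise verbatim; §1 at the witness.
CONDITIONAL; nothing of Bałaban asserted. [cite: Balaban1985Variational, (6)–(7) p.278, Thm 1 (8)–(9) p.279, (144)–(152) pp.300–301, Prop. 8 p.304, p.304 lines 1–2; Balaban1985RegularSpaces, (1.3)–(1.9) p.77; Balaban1988Convergent, Thm 1 p.262, (2.1) p.254, (2.4)–(2.8) pp.255–256, (2.12)–(2.13) pp.256–257, (2.18) p.257, (2.25)–(2.28) pp.258–259; Balaban1987RG1, Thm 1 p.259, (1.12) p.262] -/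
theorem bgSepCoPAt_theta13OfThm1CCMW_of_thm1RegSepCoP7MR_of_thm1GaugeR_of_hcomp_allTorus (hγ0 : 0 < γ) (hγ : γ ≤ 1 / 2) (hε : 0 < ε₀) (hε' : 0 < ε₂₉) (hB : 0 ≤ B₃) (hB' : 0 ≤ B₃')
    (ha₀ : 0 < a₀) (ha₁ : 0 < a₁) (h15 : VariationalThm1RegSepCoP7MGB F N (floorGuard F c) (lamDatum F) Dat B₃ a₀ a₁) (hc : c ≤ F.L ^ j)
    (h15G : VariationalThm1GaugeRegSepCoP7MGB F N (F.L ^ j) (floorGuard F c) (lamDatum F) Dat B₃ B₃' a₀ a₁)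
    (hDat : ∀ (θ : Stage13Params F N) (p : B12.RunParams) (n : ℕ) (s : SeqOfRecord F θ.ν θ.τ9.M (gOfRecord₁₃ F N θ p) p.K n) (δ : ℕ → ℝ) (W : MSField (F.P p.K) (SU N)), n ≤ p.K → PartCompat₁₃ F N θ p n →
      Sect2.DataSmall7PTop (avOfRecord F N p.K) s.Ω (suppDomOfRecord F θ.ν p.K s.Ω) n δ W → Dat p.K s.Ω (suppDomOfRecord F θ.ν p.K s.Ω) n δ W)
    (hseam : ∀ (θ : Stage13Params F N) (p : B12.RunParams) (n : ℕ) (s : SeqOfRecord F θ.ν θ.τ9.M (gOfRecord₁₃ F N θ p) p.K (n + 1)) (W : MSField (F.P p.K) (SU N)),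
      UbgOfRecord₁₃CoP F N θ p (n + 1) s W = UbgMSCoPOfRecordB F N θ.ν θ.τ9.M (gOfRecord₁₃ F N θ p) p.K (n + 1) s W)
    (hcomp : ∀ (p : B12.RunParams) (n : ℕ), n ≤ p.K → Step.InInterval (theta13OfThm1CCMW F N j γ ε₀ ε₂₉ B₃ B₃' a₀ a₁).γ n (gOfRecord₁₃ F N (theta13OfThm1CCMW F N j γ ε₀ ε₂₉ B₃ B₃' a₀ a₁) p) → ∀ m, m < n →
      (theta13OfThm1CCMW F N j γ ε₀ ε₂₉ B₃ B₃' a₀ a₁).s2.cR * epsOfRecord (theta13OfThm1CCMW F N j γ ε₀ ε₂₉ B₃ B₃' a₀ a₁).ν (gOfRecord₁₃ F N (theta13OfThm1CCMW F N j γ ε₀ ε₂₉ B₃ B₃' a₀ a₁) p) m ≤ 2 * ((theta13OfThm1CCMW F N j γ ε₀ ε₂₉ B₃ B₃' a₀ a₁).s2.cR * epsOfRecord (theta13OfThm1CCMW F N j γ ε₀ ε₂₉ B₃ B₃' a₀ a₁).ν (gOfRecord₁₃ F N (theta13OfThm1CCMW F N j γ ε₀ ε₂₉ B₃ B₃' a₀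 a₁) p) (m + 1)))
    (hcompRev : ∀ (p : B12.RunParams) (n : ℕ), n ≤ p.K → Step.InInterval (theta13OfThm1CCMW F N j γ ε₀ ε₂₉ B₃ B₃' a₀ a₁).γ n (gOfRecord₁₃ F N (theta13OfThm1CCMW F N j γ ε₀ ε₂₉ B₃ B₃' a₀ a₁) p) → ∀ m, m < n →
      (theta13OfThm1CCMW F N j γ ε₀ ε₂₉ B₃ B₃' a₀ a₁).s2.cR * epsOfRecord (theta13OfThm1CCMW F N j γ ε₀ ε₂₉ B₃ B₃' a₀ a₁).ν (gOfRecord₁₃ F N (theta13OfThm1CCMW F N j γ ε₀ ε₂₉ B₃ B₃' a₀ a₁) p) (m + 1) ≤ 2 * ((theta13OfThm1CCMW F N j γ ε₀ ε₂₉ B₃ B₃' a₀ a₁).s2.cR * epsOfRecord (theta13OfThm1CCMW F N j γ ε₀ ε₂₉ B₃ B₃' a₀ a₁).ν (gOfRecord₁₃ F N (theta13OfThm1CCMW F N j γ ε₀ ε₂₉ B₃ B₃' a₀ a₁) p) m)) :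
    ∀ (p : B12.RunParams) (n : ℕ), n ≤ p.K → Step.InInterval (theta13OfThm1CCMW F N j γ ε₀ ε₂₉ B₃ B₃' a₀ a₁).γ n (gOfRecord₁₃ F N (theta13OfThm1CCMW F N j γ ε₀ ε₂₉ B₃ B₃' a₀ a₁) p) → PartCompat₁₃ F N (theta13OfThm1CCMW F N j γ ε₀ ε₂₉ B₃ B₃' a₀ a₁) p n →
      ∀ s : SeqOfRecord F (theta13OfThm1CCMW F N j γ ε₀ ε₂₉ B₃ B₃' a₀ a₁).ν (theta13OfThm1CCMW F N j γ ε₀ ε₂₉ B₃ B₃' a₀ a₁).τ9.M (gOfRecord₁₃ F N (theta13OfThm1CCMW F N j γ ε₀ ε₂₉ B₃ B₃' a₀ a₁) p) p.K n, Sect2.SeqSeparated (theta13OfThm1CCMW F N j γ ε₀ ε₂₉ B₃ B₃' a₀ a₁).ν.M₁ s →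
      ∀ W : MSField (F.P p.K) (SU N), W ∈ suppOfRecord₁₃P F N (theta13OfThm1CCMW F N j γ ε₀ ε₂₉ B₃ B₃' a₀ a₁) p n s →
      Sect2.DataSmall7PTop (avOfRecord F N p.K) s.Ω (suppDomOfRecord F (theta13OfThm1CCMW F N j γ ε₀ ε₂₉ B₃ B₃' a₀ a₁).ν p.K s.Ω) n (fun j' => (theta13OfThm1CCMW F N j γ ε₀ ε₂₉ B₃ B₃' a₀ a₁).s2.cR * epsOfRecord (theta13OfThm1CCMW F N j γ ε₀ ε₂₉ B₃ B₃' a₀ a₁).ν (gOfRecord₁₃ F N (theta13OfThm1CCMW F N j γ ε₀ ε₂₉ B₃ B₃' a₀ a₁) p) j') W →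
      ∀ j', 1 ≤ j' → j' ≤ n → ∀ X : (Sect2.domSys (F.P p.K) (theta13OfThm1CCMW F N j γ ε₀ ε₂₉ B₃ B₃' a₀ a₁).τ9.M j').Dom,
      (Sect2.domSites (F.P p.K) (theta13OfThm1CCMW F N j γ ε₀ ε₂₉ B₃ B₃' a₀ a₁).τ9.M j' X ⊆ s.Λ j' →
        Sect2.ofBackgroundC (settingOfRecord₁₃ F N (theta13OfThm1CCMW F N j γ ε₀ ε₂₉ B₃ B₃' a₀ a₁) p).ι (UbgOfRecord₁₃CoP F N (theta13OfThm1CCMW F N j γ ε₀ ε₂₉ B₃ B₃' a₀ a₁) p n s W) ∈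
          Sect2.spaceI (settingOfRecord₁₃ F N (theta13OfThm1CCMW F N j γ ε₀ ε₂₉ B₃ B₃' a₀ a₁) p) ((theta13OfThm1CCMW F N j γ ε₀ ε₂₉ B₃ B₃' a₀ a₁).Rz p.K) (theta13OfThm1CCMW F N j γ ε₀ ε₂₉ B₃ B₃' a₀ a₁).τ9.M j' (Sect2.domSites (F.P p.K) (theta13OfThm1CCMW F N j γ ε₀ ε₂₉ B₃ B₃' a₀ a₁).τ9.M j' X)
            ((settingOfRecord₁₃ F N (theta13OfThm1CCMW F N j γ ε₀ ε₂₉ B₃ B₃' a₀ a₁) p).lf.alpha0 ((settingOfRecord₁₃ F N (theta13OfThm1CCMW F N j γ ε₀ ε₂₉ B₃ B₃' a₀ a₁) p).flow.g j')) ((settingOfRecord₁₃ F N (theta13OfThm1CCMW F N j γ ε₀ ε₂₉ B₃ B₃' a₀ a₁) p).lf.alpha1 ((settingOfRecord₁₃ F N (theta13OfThm1CCMW F N j γ ε₀ ε₂₉ B₃ B₃' a₀ a₁) p).flow.g j'))) ∧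
      (Sect2.admB (F.P p.K) (theta13OfThm1CCMW F N j γ ε₀ ε₂₉ B₃ B₃' a₀ a₁).ν (theta13OfThm1CCMW F N j γ ε₀ ε₂₉ B₃ B₃' a₀ a₁).τ9.M (gOfRecord₁₃ F N (theta13OfThm1CCMW F N j γ ε₀ ε₂₉ B₃ B₃' a₀ a₁) p) s.Ω s.Λ j' (Sect2.domSites (F.P p.K) (theta13OfThm1CCMW F N j γ ε₀ ε₂₉ B₃ B₃' a₀ a₁).τ9.M j' X) = true →
        Sect2.ofBackgroundC (settingOfRecord₁₃ F N (theta13OfThm1CCMW F N j γ ε₀ ε₂₉ B₃ B₃' a₀ a₁) p).ι (UbgOfRecord₁₃CoP F N (theta13OfThm1CCMW F N j γ ε₀ ε₂₉ B₃ B₃' a₀ a₁) p n s W) ∈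
          Sect2.spaceMS (settingOfRecord₁₃ F N (theta13OfThm1CCMW F N j γ ε₀ ε₂₉ B₃ B₃' a₀ a₁) p) ((theta13OfThm1CCMW F N j γ ε₀ ε₂₉ B₃ B₃' a₀ a₁).Rz p.K) (theta13OfThm1CCMW F N j γ ε₀ ε₂₉ B₃ B₃' a₀ a₁).τ9.M j' (Sect2.domSites (F.P p.K) (theta13OfThm1CCMW F N j γ ε₀ ε₂₉ B₃ B₃' a₀ a₁).τ9.M j' X) s.Ω) := by
  intro p n hn hw hpc s hsep W _ h7
  cases n with
  | zero => intro j' h1 hj'; exfalso; omega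
  | succ n =>
    rw [hseam]
    exact bgAtDatumCoP_of_thm1RegSepCoP7MR_of_thm1GaugeR_allTorus (theta13OfThm1CCMW F N j γ ε₀ ε₂₉ B₃ B₃' a₀ a₁)
      (admissible_theta13OfThm1CCMW_of_le_half F N hγ0 hγ hε hε' hB hB' ha₀ ha₁) rfl
      (τ9_M_pos_theta13OfThm1CCMW F N j γ ε₀ ε₂₉ B₃ B₃' a₀ a₁) (by rw [theta13OfThm1CCMW_M₁]; exact hc) h15 h15G (hnum_theta13OfThm1CCMW hγ hB hB' ha₀ ha₁) εreg_le_theta13OfThm1CCMW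
      hcomp hcompRev (hBα_theta13OfThm1CCMW hγ hB hB' ha₀.le ha₁.le)
      (htI_theta13OfThm1CCMW hγ hB hB' ha₀.le ha₁.le) (htMS_theta13OfThm1CCMW hγ hB hB' ha₀.le ha₁.le) (hC1_theta13OfThm1CCMW hγ) ⟨j, theta13OfThm1CCMW_τ9_M F N j γ ε₀ ε₂₉ B₃ B₃' a₀ a₁⟩
      p (n + 1) hn hw hpc s hsep (M₁_pos_theta13OfThm1CCMW F N j γ ε₀ ε₂₉ B₃ B₃' a₀ a₁) W (hDat _ p (n + 1) s _ W hn hpc h7)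

end AtWitnessFloor

/-! ## §3  Closers keyed on the floor-carrying (8), (hcomp) ∧ (hcompRev), on EVERY family -/

section ClosersFloor

variable {j c : ℕ} {γ ε₀ ε₂₉ B₃ B₃' a₀ a₁ : ℝ}

/-- **THE v1.5 K0 BODY (⁵) FOR `F` AT `N = 2` AT `θ₁₅ᶜᶜᴹ(j; γ)` FROM `0 < γ ≤ ½`, THE FLOOR-CARRYING (8) AT FLOOR `c ≤ L^j`, THE R GAUGE SENTENCE AND (hcomp) ∧ (hcompRev), ON EVERY FAMILY**
(16a's socket ∘ §2) — p575996 §4's `exists_k0SepCoP_thm1CCMW_of_thm1GaugeR_of_hcomp_allTorus` at `h15R`.  CONDITIONAL; K0 NOT closed here.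
[cite: Balaban1985Variational, Thm 1 (8)–(9) p.279, (152) p.301, Prop. 8 p.304, p.304 lines 1–2; Balaban1988Convergent, Thm 1 p.262, (2.4)–(2.8) pp.255–256, p.257; Balaban1987RG1, Thm 1 p.259] -/
theorem exists_k0SepCoP_thm1CCMW_of_thm1RegSepCoP7MR_of_thm1GaugeR_of_hcomp_allTorus (F : T4Family) {Dat : TopData F 2} (hγ0 : 0 < γ) (hγ : γ ≤ 1 / 2) (hε : 0 < ε₀) (hε' : 0 < ε₂₉) (hB : 0 ≤ B₃)
    (hB' : 0 ≤ B₃') (ha₀ : 0 < a₀) (ha₁ : 0 < a₁) (h15 : VariationalThm1RegSepCoP7MGB F 2 (floorGuard F c) (lamDatum F) Dat B₃ a₀ a₁) (hc : c ≤ F.L ^ j)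
    (h15G : VariationalThm1GaugeRegSepCoP7MGB F 2 (F.L ^ j) (floorGuard F c) (lamDatum F) Dat B₃ B₃' a₀ a₁)
    (hDat : ∀ (θ : Stage13Params F 2) (p : B12.RunParams) (n : ℕ) (s : SeqOfRecord F θ.ν θ.τ9.M (gOfRecord₁₃ F 2 θ p) p.K n) (δ : ℕ → ℝ) (W : MSField (F.P p.K) (SU 2)), n ≤ p.K → PartCompat₁₃ F 2 θ p n →
      Sect2.DataSmall7PTop (avOfRecord F 2 p.K) s.Ω (suppDomOfRecord F θ.ν p.K s.Ω) n δ W → Dat p.K s.Ω (suppDomOfRecord F θ.ν p.K s.Ω) n δ W)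
    (hseam : ∀ (θ : Stage13Params F 2) (p : B12.RunParams) (n : ℕ) (s : SeqOfRecord F θ.ν θ.τ9.M (gOfRecord₁₃ F 2 θ p) p.K (n + 1)) (W : MSField (F.P p.K) (SU 2)),
      UbgOfRecord₁₃CoP F 2 θ p (n + 1) s W = UbgMSCoPOfRecordB F 2 θ.ν θ.τ9.M (gOfRecord₁₃ F 2 θ p) p.K (n + 1) s W)
    (hcomp : ∀ (p : B12.RunParams) (n : ℕ), n ≤ p.K → Step.InInterval (theta13OfThm1CCMW F 2 j γ ε₀ ε₂₉ B₃ B₃' a₀ a₁).γ n (gOfRecord₁₃ F 2 (theta13OfThm1CCMW F 2 j γ ε₀ ε₂₉ B₃ B₃' a₀ a₁) p) → ∀ m, m < n →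
      (theta13OfThm1CCMW F 2 j γ ε₀ ε₂₉ B₃ B₃' a₀ a₁).s2.cR * epsOfRecord (theta13OfThm1CCMW F 2 j γ ε₀ ε₂₉ B₃ B₃' a₀ a₁).ν (gOfRecord₁₃ F 2 (theta13OfThm1CCMW F 2 j γ ε₀ ε₂₉ B₃ B₃' a₀ a₁) p) m ≤ 2 * ((theta13OfThm1CCMW F 2 j γ ε₀ ε₂₉ B₃ B₃' a₀ a₁).s2.cR * epsOfRecord (theta13OfThm1CCMW F 2 j γ ε₀ ε₂₉ B₃ B₃' a₀ a₁).ν (gOfRecord₁₃ F 2 (theta13OfThm1CCMW F 2 j γ ε₀ ε₂₉ B₃ B₃' a₀ a₁) p) (m + 1)))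
    (hcompRev : ∀ (p : B12.RunParams) (n : ℕ), n ≤ p.K → Step.InInterval (theta13OfThm1CCMW F 2 j γ ε₀ ε₂₉ B₃ B₃' a₀ a₁).γ n (gOfRecord₁₃ F 2 (theta13OfThm1CCMW F 2 j γ ε₀ ε₂₉ B₃ B₃' a₀ a₁) p) → ∀ m, m < n →
      (theta13OfThm1CCMW F 2 j γ ε₀ ε₂₉ B₃ B₃' a₀ a₁).s2.cR * epsOfRecord (theta13OfThm1CCMW F 2 j γ ε₀ ε₂₉ B₃ B₃' a₀ a₁).ν (gOfRecord₁₃ F 2 (theta13OfThm1CCMW F 2 j γ ε₀ ε₂₉ B₃ B₃' a₀ a₁) p) (m + 1) ≤ 2 * ((theta13OfThm1CCMW F 2 j γ ε₀ ε₂₉ B₃ B₃' a₀ a₁).s2.cR * epsOfRecord (theta13OfThm1CCMW F 2 j γ ε₀ ε₂₉ B₃ B₃' a₀ a₁).ν (gOfRecord₁₃ F 2 (theta13OfThm1CCMW F 2 j γ ε₀ ε₂₉ B₃ B₃' a₀ a₁) p) m)) :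
    ∃ θ : Stage13Params F 2, θ.Provisos₁₃SepCoP F 2 ∧ (θ.ZtUnity F 2 ∧ θ.SlotsNondegenerate₁₃ F 2) ∧ θ.Admissible F 2 :=
  exists_k0SepCoP_of_bgSepCoP_theta13LiveOfNumerics F (stage12NumericsOfThm1CCMW_pos_of_le_half (L := F.L) (j := j) F.hL.2.le hγ0 hγ hε hB hB' ha₀ ha₁) hε' ⟨j, rfl⟩ (dvd_refl _)
    (bgSepCoPAt_theta13OfThm1CCMW_of_thm1RegSepCoP7MR_of_thm1GaugeR_of_hcomp_allTorus hγ0 hγ hε hε' hB hB' ha₀ ha₁ h15 hc h15G hDat hseam hcomp hcompRev)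

/-- **THE ⁷ IMAGE, ON EVERY FAMILY, FROM THE FLOOR-CARRYING (8)** (FILE 18's cured lift, T's history-blind door) — p575996 §4's `exists_k0SepCoPH_thm1CCMW_of_thm1GaugeR_of_hcomp_allTorus` at `h15R`.
[cite: Balaban1985Variational, Thm 1 (8) p.279, Prop. 8 p.304, p.304 lines 1–2; Balaban1988Convergent, Thm 1 p.262, (2.21) p.258, (3.16)–(3.23) pp.268–270; Balaban1989LargeFieldI, (0.2)–(0.4) p.176] -/
theorem exists_k0SepCoPH_thm1CCMW_of_thm1RegSepCoP7MR_of_thm1GaugeR_of_hcomp_allTorus (F : T4Family) {Dat : TopData F 2} (hγ0 : 0 < γ) (hγ : γ ≤ 1 / 2) (hε : 0 < ε₀) (hε' : 0 < ε₂₉) (hB : 0 ≤ B₃)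
    (hB' : 0 ≤ B₃') (ha₀ : 0 < a₀) (ha₁ : 0 < a₁) (h15 : VariationalThm1RegSepCoP7MGB F 2 (floorGuard F c) (lamDatum F) Dat B₃ a₀ a₁) (hc : c ≤ F.L ^ j)
    (h15G : VariationalThm1GaugeRegSepCoP7MGB F 2 (F.L ^ j) (floorGuard F c) (lamDatum F) Dat B₃ B₃' a₀ a₁)
    (hDat : ∀ (θ : Stage13Params F 2) (p : B12.RunParams) (n : ℕ) (s : SeqOfRecord F θ.ν θ.τ9.M (gOfRecord₁₃ F 2 θ p) p.K n) (δ : ℕ → ℝ) (W : MSField (F.P p.K) (SU 2)), n ≤ p.K → PartCompat₁₃ F 2 θ p n →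
      Sect2.DataSmall7PTop (avOfRecord F 2 p.K) s.Ω (suppDomOfRecord F θ.ν p.K s.Ω) n δ W → Dat p.K s.Ω (suppDomOfRecord F θ.ν p.K s.Ω) n δ W)
    (hseam : ∀ (θ : Stage13Params F 2) (p : B12.RunParams) (n : ℕ) (s : SeqOfRecord F θ.ν θ.τ9.M (gOfRecord₁₃ F 2 θ p) p.K (n + 1)) (W : MSField (F.P p.K) (SU 2)),
      UbgOfRecord₁₃CoP F 2 θ p (n + 1) s W = UbgMSCoPOfRecordB F 2 θ.ν θ.τ9.M (gOfRecord₁₃ F 2 θ p) p.K (n + 1) s W)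
    (hcomp : ∀ (p : B12.RunParams) (n : ℕ), n ≤ p.K → Step.InInterval (theta13OfThm1CCMW F 2 j γ ε₀ ε₂₉ B₃ B₃' a₀ a₁).γ n (gOfRecord₁₃ F 2 (theta13OfThm1CCMW F 2 j γ ε₀ ε₂₉ B₃ B₃' a₀ a₁) p) → ∀ m, m < n →
      (theta13OfThm1CCMW F 2 j γ ε₀ ε₂₉ B₃ B₃' a₀ a₁).s2.cR * epsOfRecord (theta13OfThm1CCMW F 2 j γ ε₀ ε₂₉ B₃ B₃' a₀ a₁).ν (gOfRecord₁₃ F 2 (theta13OfThm1CCMW F 2 j γ ε₀ ε₂₉ B₃ B₃' a₀ a₁) p) m ≤ 2 * ((theta13OfThm1CCMW F 2 j γ ε₀ ε₂₉ B₃ B₃' a₀ a₁).s2.cR * epsOfRecord (theta13OfThm1CCMW F 2 j γ ε₀ ε₂₉ B₃ B₃' a₀ a₁).ν (gOfRecord₁₃ F 2 (theta13OfThm1CCMW F 2 j γ ε₀ ε₂₉ B₃ B₃' a₀ a₁) p) (m + 1)))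
    (hcompRev : ∀ (p : B12.RunParams) (n : ℕ), n ≤ p.K → Step.InInterval (theta13OfThm1CCMW F 2 j γ ε₀ ε₂₉ B₃ B₃' a₀ a₁).γ n (gOfRecord₁₃ F 2 (theta13OfThm1CCMW F 2 j γ ε₀ ε₂₉ B₃ B₃' a₀ a₁) p) → ∀ m, m < n →
      (theta13OfThm1CCMW F 2 j γ ε₀ ε₂₉ B₃ B₃' a₀ a₁).s2.cR * epsOfRecord (theta13OfThm1CCMW F 2 j γ ε₀ ε₂₉ B₃ B₃' a₀ a₁).ν (gOfRecord₁₃ F 2 (theta13OfThm1CCMW F 2 j γ ε₀ ε₂₉ B₃ B₃' a₀ a₁) p) (m + 1) ≤ 2 * ((theta13OfThm1CCMW F 2 j γ ε₀ ε₂₉ B₃ B₃' a₀ a₁).s2.cR * epsOfRecord (theta13OfThm1CCMW F 2 j γ ε₀ ε₂₉ B₃ B₃' a₀ a₁).ν (gOfRecord₁₃ F 2 (theta13OfThm1CCMW F 2 j γ ε₀ ε₂₉ B₃ B₃' a₀ a₁) p) m)) :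
    ∃ θ : Stage13HParams F 2, θ.Provisos₁₃SepCoPH F 2 ∧ (θ.ZhUnity F 2 ∧ θ.SlotsNondegenerate₁₃ F 2) ∧ θ.Admissible F 2 :=
  exists_k0SepCoPH_of_exists_k0SepCoPR (exists_k0SepCoPR_of_exists_k0SepCoP F
    (exists_k0SepCoP_thm1CCMW_of_thm1RegSepCoP7MR_of_thm1GaugeR_of_hcomp_allTorus F hγ0 hγ hε hε' hB hB' ha₀ ha₁ h15 hc h15G hDat hseam hcomp hcompRev))

/-- **THE ⁷ K0 BODY KEYED ON THE FLOOR-CARRYING (8) AND dag-n07-e's FLOOR-CARRYING (9)-STEP FACT AT `(L^j, c)`, (hcomp) ∧ (hcompRev), ON EVERY FAMILY** (B′ §4: minimal ⇒ critical,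
`variationalThm1GaugeRegSepCoP7MR_of_gauge9TopStepR`) — p575996 §4's `exists_k0SepCoPH_thm1CCMW_of_gauge9TopStepR_of_hcomp_allTorus` at `h15R`.  CONDITIONAL.
[cite: Balaban1985Variational, Thm 1 (8)–(9) p.279, (144)–(152) pp.300–301, Prop. 8 p.304, p.304 lines 1–2; Balaban1988Convergent, Thm 1 p.262, (2.21) p.258, p.257; Balaban1989LargeFieldI, (0.2)–(0.4) p.176] -/
theorem exists_k0SepCoPH_thm1CCMW_of_thm1RegSepCoP7MR_of_gauge9TopStepR_of_hcomp_allTorus (F : T4Family) {Dat : TopData F 2} (hγ0 : 0 < γ) (hγ : γ ≤ 1 / 2) (hε : 0 < ε₀) (hε' : 0 < ε₂₉)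
    (hB : 0 ≤ B₃) (hB' : 0 ≤ B₃') (ha₀ : 0 < a₀) (ha₁ : 0 < a₁) (h15 : VariationalThm1RegSepCoP7MGB F 2 (floorGuard F c) (lamDatum F) Dat B₃ a₀ a₁) (hc : c ≤ F.L ^ j)
    (h9 : Gauge9RegSepTopStepGB F 2 (fun ν K Ω => suppDomOfRecord F ν K Ω) (F.L ^ j) (floorGuard F c) (lamDatum F) Dat B₃ B₃' a₀ a₁)
    (hDat : ∀ (θ : Stage13Params F 2) (p : B12.RunParams) (n : ℕ) (s : SeqOfRecord F θ.ν θ.τ9.M (gOfRecord₁₃ F 2 θ p) p.K n) (δ : ℕ → ℝ) (W : MSField (F.P p.K) (SU 2)), n ≤ p.K → PartCompat₁₃ F 2 θ p n →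
      Sect2.DataSmall7PTop (avOfRecord F 2 p.K) s.Ω (suppDomOfRecord F θ.ν p.K s.Ω) n δ W → Dat p.K s.Ω (suppDomOfRecord F θ.ν p.K s.Ω) n δ W)
    (hseam : ∀ (θ : Stage13Params F 2) (p : B12.RunParams) (n : ℕ) (s : SeqOfRecord F θ.ν θ.τ9.M (gOfRecord₁₃ F 2 θ p) p.K (n + 1)) (W : MSField (F.P p.K) (SU 2)),
      UbgOfRecord₁₃CoP F 2 θ p (n + 1) s W = UbgMSCoPOfRecordB F 2 θ.ν θ.τ9.M (gOfRecord₁₃ F 2 θ p) p.K (n + 1) s W)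
    (hcomp : ∀ (p : B12.RunParams) (n : ℕ), n ≤ p.K → Step.InInterval (theta13OfThm1CCMW F 2 j γ ε₀ ε₂₉ B₃ B₃' a₀ a₁).γ n (gOfRecord₁₃ F 2 (theta13OfThm1CCMW F 2 j γ ε₀ ε₂₉ B₃ B₃' a₀ a₁) p) → ∀ m, m < n →
      (theta13OfThm1CCMW F 2 j γ ε₀ ε₂₉ B₃ B₃' a₀ a₁).s2.cR * epsOfRecord (theta13OfThm1CCMW F 2 j γ ε₀ ε₂₉ B₃ B₃' a₀ a₁).ν (gOfRecord₁₃ F 2 (theta13OfThm1CCMW F 2 j γ ε₀ ε₂₉ B₃ B₃' a₀ a₁) p) m ≤ 2 * ((theta13OfThm1CCMW F 2 j γ ε₀ ε₂₉ B₃ B₃' a₀ a₁).s2.cR * epsOfRecord (theta13OfThm1CCMW F 2 j γ ε₀ ε₂₉ B₃ B₃' a₀ a₁).ν (gOfRecord₁₃ F 2 (theta13OfThm1CCMW F 2 j γ ε₀ ε₂₉ B₃ B₃' a₀ a₁) p) (m + 1)))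
    (hcompRev : ∀ (p : B12.RunParams) (n : ℕ), n ≤ p.K → Step.InInterval (theta13OfThm1CCMW F 2 j γ ε₀ ε₂₉ B₃ B₃' a₀ a₁).γ n (gOfRecord₁₃ F 2 (theta13OfThm1CCMW F 2 j γ ε₀ ε₂₉ B₃ B₃' a₀ a₁) p) → ∀ m, m < n →
      (theta13OfThm1CCMW F 2 j γ ε₀ ε₂₉ B₃ B₃' a₀ a₁).s2.cR * epsOfRecord (theta13OfThm1CCMW F 2 j γ ε₀ ε₂₉ B₃ B₃' a₀ a₁).ν (gOfRecord₁₃ F 2 (theta13OfThm1CCMW F 2 j γ ε₀ ε₂₉ B₃ B₃' a₀ a₁) p) (m + 1) ≤ 2 * ((theta13OfThm1CCMW F 2 j γ ε₀ ε₂₉ B₃ B₃' a₀ a₁).s2.cR * epsOfRecord (theta13OfThm1CCMW F 2 j γ ε₀ ε₂₉ B₃ B₃' a₀ a₁).ν (gOfRecord₁₃ F 2 (theta13OfThm1CCMW F 2 j γ ε₀ ε₂₉ B₃ B₃' a₀ a₁) p) m)) :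
    ∃ θ : Stage13HParams F 2, θ.Provisos₁₃SepCoPH F 2 ∧ (θ.ZhUnity F 2 ∧ θ.SlotsNondegenerate₁₃ F 2) ∧ θ.Admissible F 2 :=
  exists_k0SepCoPH_thm1CCMW_of_thm1RegSepCoP7MR_of_thm1GaugeR_of_hcomp_allTorus F hγ0 hγ hε hε' hB hB' ha₀ ha₁ h15 hc
    (variationalThm1GaugeRegSepCoP7MGB_of_gauge9TopStepGB h9) hDat hseam hcomp hcompRev

end ClosersFloor

/-! ## §4  PART 1 re-keyed: the body at an arbitrary cube letter `(L^j, c)`, the stub-level composition with a GENERIC R-supplier, NODE O's socket on the R text -/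

section Part1Floor

section ClausesPrivate

variable (F : T4Family) (j : ℕ) {B₃ B₃' a₀ a₁ : ℝ}

/-- (PRIVATE verbatim re-home of the residue module `…K0GenericCubeOfStepTokensR` §1, director-ym №366 R2.) **ONE ABS β-BOX ⟹ THE SIGN-FREE CLAUSES, AT ANY INDEX `j`**: an abs box `−β′ ≤ β₁₃(θ₁₅ᶜᶜᴹ(j; ε₀, ε₂₉)) ≤ β′` on some window `]0, γ₀]` (thresholds chosen with the box) gives, for
`0 ≤ B₃, B₃′, a₀, a₁`, a window `γ ∈ ]0, ½]` with (hcomp) ∧ (hcompRev) along every `γ`-windowed run of `θ₁₅ᶜᶜᴹᵂ(j; γ)` — the window shrink `exists_window_letters_signFree` (Dʷ §0; `0 ≤ β′`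
read off the box at `k = 0`) then Dʷ∕Eʷ's `hcompBoth_theta13OfThm1CCMW_of_betaBoxSignFree_half`.  No (8)∕(9) token is read by this step (Cʷ′ `clausesH_of_absBetaBox` carries them only as
binders).  CONDITIONAL on the box. [cite: Balaban1987RG1, Thm 1 p.259, (0.20) p.256, (1.20)–(1.22) p.264, §1 p.264; Balaban1988Convergent, (2.4)–(2.8) pp.255–256] -/
private theorem clausesH_of_absBox (hB : 0 ≤ B₃) (hB' : 0 ≤ B₃') (ha₀ : 0 ≤ a₀) (ha₁ : 0 ≤ a₁)
    (h : ∃ γ₀ ε₀ ε₂₉ β' : ℝ, 0 < γ₀ ∧ 0 < ε₀ ∧ 0 < ε₂₉ ∧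
        BetaLowerH (-β') γ₀ (betaOfRecord₁₃ F 2 (theta13OfThm1CCM F 2 j ε₀ ε₂₉ B₃ B₃' a₀ a₁)) ∧
        BetaUpperH β' γ₀ (betaOfRecord₁₃ F 2 (theta13OfThm1CCM F 2 j ε₀ ε₂₉ B₃ B₃' a₀ a₁))) :
    ∃ γ ε₀ ε₂₉ : ℝ, 0 < γ ∧ γ ≤ 1 / 2 ∧ 0 < ε₀ ∧ 0 < ε₂₉ ∧
        (∀ (p : B12.RunParams) (n : ℕ), n ≤ p.K → Step.InInterval (theta13OfThm1CCMW F 2 j γ ε₀ ε₂₉ B₃ B₃' a₀ a₁).γ n (gOfRecord₁₃ F 2 (theta13OfThm1CCMW F 2 j γ ε₀ ε₂₉ B₃ B₃' a₀ a₁) p) → ∀ m, m < n →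
          (theta13OfThm1CCMW F 2 j γ ε₀ ε₂₉ B₃ B₃' a₀ a₁).s2.cR * epsOfRecord (theta13OfThm1CCMW F 2 j γ ε₀ ε₂₉ B₃ B₃' a₀ a₁).ν (gOfRecord₁₃ F 2 (theta13OfThm1CCMW F 2 j γ ε₀ ε₂₉ B₃ B₃' a₀ a₁) p) m ≤
            2 * ((theta13OfThm1CCMW F 2 j γ ε₀ ε₂₉ B₃ B₃' a₀ a₁).s2.cR * epsOfRecord (theta13OfThm1CCMW F 2 j γ ε₀ ε₂₉ B₃ B₃' a₀ a₁).ν (gOfRecord₁₃ F 2 (theta13OfThm1CCMW F 2 j γ ε₀ ε₂₉ B₃ B₃' a₀ a₁) p) (m + 1))) ∧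
        (∀ (p : B12.RunParams) (n : ℕ), n ≤ p.K → Step.InInterval (theta13OfThm1CCMW F 2 j γ ε₀ ε₂₉ B₃ B₃' a₀ a₁).γ n (gOfRecord₁₃ F 2 (theta13OfThm1CCMW F 2 j γ ε₀ ε₂₉ B₃ B₃' a₀ a₁) p) → ∀ m, m < n →
          (theta13OfThm1CCMW F 2 j γ ε₀ ε₂₉ B₃ B₃' a₀ a₁).s2.cR * epsOfRecord (theta13OfThm1CCMW F 2 j γ ε₀ ε₂₉ B₃ B₃' a₀ a₁).ν (gOfRecord₁₃ F 2 (theta13OfThm1CCMW F 2 j γ ε₀ ε₂₉ B₃ B₃' a₀ a₁) p) (m + 1) ≤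
            2 * ((theta13OfThm1CCMW F 2 j γ ε₀ ε₂₉ B₃ B₃' a₀ a₁).s2.cR * epsOfRecord (theta13OfThm1CCMW F 2 j γ ε₀ ε₂₉ B₃ B₃' a₀ a₁).ν (gOfRecord₁₃ F 2 (theta13OfThm1CCMW F 2 j γ ε₀ ε₂₉ B₃ B₃' a₀ a₁) p) m)) := by
  obtain ⟨γ₀, ε₀, ε₂₉, β', hγ0, hε, hε', hlow, hup⟩ := h
  have hv : (fun _ : Fin (0 + 1) => γ₀) ∈ Box γ₀ 0 := mem_box.mpr fun _ => ⟨hγ0, le_rfl⟩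
  have hβ' : 0 ≤ β' := by
    have h1 := hlow 0 _ hv
    have h2 := hup 0 _ hv
    linarith
  obtain ⟨γ, hγpos, hγle, hγhalf, hl, hu⟩ := exists_window_letters_signFree hγ0 hβ'
  exact ⟨γ, ε₀, ε₂₉, hγpos, hγhalf, hε, hε',
    hcompBoth_theta13OfThm1CCMW_of_betaBoxSignFree_half hγhalf hB hB' ha₀ ha₁ (fun k v hv => hlow k v (box_mono hγle k hv))
      (fun k v hv => hup k v (box_mono hγle k hv)) hl hu⟩

end ClausesPrivate

/-- **★ THE ⁷ K0 BODY FOR `F` AT AN ARBITRARY CUBE LETTER `(L^j, c)` WITH `c ≤ L^j`, FROM THE FLOOR-CARRYING (8) AT FLOOR `c`, THE (9)-TOKEN AT `(L^j, c)` AND ONE ABS β-BOX OF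
`θ₁₅ᶜᶜᴹ(j)`** — PART 1's `exists_k0H_of_thm1CoP7M_of_gauge9R_of_absBox` (p589753 §2) at `h15R`: PART 1 §1 `clausesH_of_absBox` (token-free) gives (hcomp) ∧ (hcompRev) at
`θ₁₅ᶜᶜᴹᵂ(j; γ)`, then §3.  CONDITIONAL. [cite: Balaban1985Variational, Thm 1 (8)–(9) p.279, (144)–(152) pp.300–301, Prop. 8 p.304, p.304 lines 1–2; Balaban1988Convergent, Thm 1 p.262, (2.6)–(2.8) pp.255–256, p.257, (2.21) p.258; Balaban1987RG1, Thm 1 p.259, (1.12) p.262, §1 p.264] -/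
theorem exists_k0H_of_thm1CoP7MR_of_gauge9R_of_absBox (F : T4Family) {Dat : TopData F 2} {j c : ℕ} (hc : c ≤ F.L ^ j) {B₃ B₉ a₀ a₁ : ℝ} (hB₃ : 0 ≤ B₃) (hB₉ : 0 ≤ B₉)
    (ha₀ : 0 < a₀) (ha₁ : 0 < a₁) (h15 : VariationalThm1RegSepCoP7MGB F 2 (floorGuard F c) (lamDatum F) Dat B₃ a₀ a₁)
    (h9 : Gauge9RegSepTopStepGB F 2 (fun ν K Ω => suppDomOfRecord F ν K Ω) (F.L ^ j) (floorGuard F c) (lamDatum F) Dat B₃ B₉ a₀ a₁)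
    (hDat : ∀ (θ : Stage13Params F 2) (p : B12.RunParams) (n : ℕ) (s : SeqOfRecord F θ.ν θ.τ9.M (gOfRecord₁₃ F 2 θ p) p.K n) (δ : ℕ → ℝ) (W : MSField (F.P p.K) (SU 2)), n ≤ p.K → PartCompat₁₃ F 2 θ p n →
      Sect2.DataSmall7PTop (avOfRecord F 2 p.K) s.Ω (suppDomOfRecord F θ.ν p.K s.Ω) n δ W → Dat p.K s.Ω (suppDomOfRecord F θ.ν p.K s.Ω) n δ W)
    (hseam : ∀ (θ : Stage13Params F 2) (p : B12.RunParams) (n : ℕ) (s : SeqOfRecord F θ.ν θ.τ9.M (gOfRecord₁₃ F 2 θ p) p.K (n + 1)) (W : MSField (F.P p.K) (SU 2)),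
      UbgOfRecord₁₃CoP F 2 θ p (n + 1) s W = UbgMSCoPOfRecordB F 2 θ.ν θ.τ9.M (gOfRecord₁₃ F 2 θ p) p.K (n + 1) s W)
    (h3A : ∃ γ₀ ε₀ ε₂₉ β' : ℝ, 0 < γ₀ ∧ 0 < ε₀ ∧ 0 < ε₂₉ ∧
        BetaLowerH (-β') γ₀ (betaOfRecord₁₃ F 2 (theta13OfThm1CCM F 2 j ε₀ ε₂₉ B₃ B₉ a₀ a₁)) ∧
        BetaUpperH β' γ₀ (betaOfRecord₁₃ F 2 (theta13OfThm1CCM F 2 j ε₀ ε₂₉ B₃ B₉ a₀ a₁))) :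
    ∃ θ : Stage13HParams F 2, θ.Provisos₁₃SepCoPH F 2 ∧ (θ.ZhUnity F 2 ∧ θ.SlotsNondegenerate₁₃ F 2) ∧ θ.Admissible F 2 := by
  obtain ⟨γ, ε₀, ε₂₉, hγ0, hγ, hε, hε', hcomp, hcompRev⟩ := clausesH_of_absBox F j hB₃ hB₉ ha₀.le ha₁.le h3A
  exact exists_k0SepCoPH_thm1CCMW_of_thm1RegSepCoP7MR_of_gauge9TopStepR_of_hcomp_allTorus F hγ0 hγ hε hε' hB₃ hB₉ ha₀ ha₁ h15 hc h9 hDat hseam hcomp hcompRev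

/-- **★★ K0⁷'s BODY AT EVERY FAMILY FROM V20-R's STUB 1, A GENERIC FLOOR-CARRYING (9)-SUPPLIER, AND V20-R's 3ᴬ′** — PART 1's `record13SepCoPHBody_of_stub1_of_gauge9Supplier_of_absBetaBoxAt`
(p589753 §3) re-keyed: `h1R` = the V20 option-R stub-1 text VERBATIM ([15] Prop. 8's top step at the record's support selector for SOME floor `c` and guarded `(B₃, a₀, a₁)`, the floor
∃-bound OUTERMOST); `hSR` = «for every family, floor `c` and guarded `(B₃, a₀, a₁)` carrying the floor-carrying top step, SOME cube letter `(j, c′)` with `c ≤ c′ ≤ L^j`, some `B₉ > 0`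
and a ceiling `0 < a₁′ ≤ a₁` carry the floor-carrying (9)-token at `(L^j, c′)`» (PART 2-R instantiates it from stub 2′ at `j := ρ₀ + 3 + c`, `c′ := max c ((11·4 + 4ρ₀L)·L)` through n07-e's
module 48 `gauge9RP_of_prop8TopStepR_of_prop6P_of_one_le`); `h3A'R` = 3ᴬ′ with the FIRST antecedent floor-carrying at the SAME `c` as the (9)-antecedent (n07-e's letter).
Proof: stub 1 ⇒ the (8) `CoP` sentence at floor `c` (`variationalThm1RegSepCoP7MR_of_prop8TopStepR`, ceiling shrunk by `.of_le`, floor raised to `c′` by `.mono_floor`), `hSR` ⇒ (9) at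
`(L^j, c′)`, `h3A'R` there ⇒ the box ⇒ `exists_k0H_of_thm1CoP7MR_of_gauge9R_of_absBox`.  CONDITIONAL; K0⁷ NOT closed here; nothing of Bałaban asserted.
[cite: Balaban1985Variational, Thm 1 (8)–(9) p.279, (144)–(152) pp.300–301, Prop. 8 p.304, p.304 lines 1–2; Balaban1985RegularSpaces, (1.3)–(1.6) p.77, Prop. 6 p.99, p.98; Balaban1988Convergent, Thm 1 p.262, (2.6)–(2.8) pp.255–256, p.257; Balaban1987RG1, Thm 1 p.259, §1 p.264] -/
theorem record13SepCoPHBody_of_stub1R_of_gauge9SupplierR_of_absBetaBoxAtR {DatF : (F : T4Family) → TopData F 2}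
    (hDat : ∀ (F : T4Family) (θ : Stage13Params F 2) (p : B12.RunParams) (n : ℕ) (s : SeqOfRecord F θ.ν θ.τ9.M (gOfRecord₁₃ F 2 θ p) p.K n) (δ : ℕ → ℝ) (W : MSField (F.P p.K) (SU 2)),
      n ≤ p.K → PartCompat₁₃ F 2 θ p n →
      Sect2.DataSmall7PTop (avOfRecord F 2 p.K) s.Ω (suppDomOfRecord F θ.ν p.K s.Ω) n δ W → DatF F p.K s.Ω (suppDomOfRecord F θ.ν p.K s.Ω) n δ W)
    (hseam : ∀ (F : T4Family) (θ : Stage13Params F 2) (p : B12.RunParams) (n : ℕ) (s : SeqOfRecord F θ.ν θ.τ9.M (gOfRecord₁₃ F 2 θ p) p.K (n + 1)) (W : MSField (F.P p.K) (SU 2)),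
      UbgOfRecord₁₃CoP F 2 θ p (n + 1) s W = UbgMSCoPOfRecordB F 2 θ.ν θ.τ9.M (gOfRecord₁₃ F 2 θ p) p.K (n + 1) s W)
    (h1R : ∀ F : T4Family, ∃ (c : ℕ) (B₃ a₀ a₁ : ℝ), 2 * (F.L : ℝ) ^ 2 ≤ B₃ ∧ 0 < a₀ ∧ 0 < a₁ ∧
      Prop8RegSepTopStepGB F 2 (fun ν K Ω => suppDomOfRecord F ν K Ω) (floorGuard F c) (lamDatum F) (DatF F) B₃ a₀ a₁)
    (hSR : ∀ (F : T4Family) (c : ℕ) (B₃ a₀ a₁ : ℝ), 2 * (F.L : ℝ) ^ 2 ≤ B₃ → 0 < a₀ → 0 < a₁ →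
      Prop8RegSepTopStepGB F 2 (fun ν K Ω => suppDomOfRecord F ν K Ω) (floorGuard F c) (lamDatum F) (DatF F) B₃ a₀ a₁ →
      ∃ (j c' : ℕ) (B₉ a₁' : ℝ), c ≤ c' ∧ c' ≤ F.L ^ j ∧ 0 < B₉ ∧ 0 < a₁' ∧ a₁' ≤ a₁ ∧
        Gauge9RegSepTopStepGB F 2 (fun ν K Ω => suppDomOfRecord F ν K Ω) (F.L ^ j) (floorGuard F c') (lamDatum F) (DatF F) B₃ B₉ a₀ a₁')
    (h3A'R : ∀ (F : T4Family) (j c : ℕ) (B₃ B₃' a₀ a₁ : ℝ), c ≤ F.L ^ j → 2 * (F.L : ℝ) ^ 2 ≤ B₃ → 0 < B₃' → 0 < a₀ → 0 < a₁ →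
      VariationalThm1RegSepCoP7MGB F 2 (floorGuard F c) (lamDatum F) (DatF F) B₃ a₀ a₁ →
      Gauge9RegSepTopStepGB F 2 (fun ν K Ω => suppDomOfRecord F ν K Ω) (F.L ^ j) (floorGuard F c) (lamDatum F) (DatF F) B₃ B₃' a₀ a₁ →
      ∃ γ₀ ε₀ ε₂₉ β' : ℝ, 0 < γ₀ ∧ 0 < ε₀ ∧ 0 < ε₂₉ ∧
        BetaLowerH (-β') γ₀ (betaOfRecord₁₃ F 2 (theta13OfThm1CCM F 2 j ε₀ ε₂₉ B₃ B₃' a₀ a₁)) ∧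
        BetaUpperH β' γ₀ (betaOfRecord₁₃ F 2 (theta13OfThm1CCM F 2 j ε₀ ε₂₉ B₃ B₃' a₀ a₁))) :
    ∀ F : T4Family, ∃ θ : Stage13HParams F 2, θ.Provisos₁₃SepCoPH F 2 ∧ (θ.ZhUnity F 2 ∧ θ.SlotsNondegenerate₁₃ F 2) ∧ θ.Admissible F 2 := by
  intro F
  obtain ⟨c, B₃, a₀, a₁, hB₃, ha₀, ha₁, h8⟩ := h1R F
  have hL : (0 : ℝ) < (F.L : ℝ) := by exact_mod_cast lt_trans Nat.zero_lt_one F.hL.2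
  have hBpos : (0 : ℝ) < B₃ := lt_of_lt_of_le (mul_pos two_pos (pow_pos hL 2)) hB₃
  obtain ⟨j, c', B₉, a₁', hcc', hc', hB₉, ha₁', ha₁'le, h9⟩ := hSR F c B₃ a₀ a₁ hB₃ ha₀ ha₁ h8
  have h15 : VariationalThm1RegSepCoP7MGB F 2 (floorGuard F c') (lamDatum F) (DatF F) B₃ a₀ a₁' :=
    variationalThm1RegSepCoP7MGB_of_prop8TopStepGB_lamDatum hBpos ((h8.of_le le_rfl ha₁'le).of_imp (floorGuard_imp_of_le hcc'))
  exact exists_k0H_of_thm1CoP7MR_of_gauge9R_of_absBox F hc' hBpos.le hB₉.le ha₀ ha₁' h15 h9 (hDat F) (hseam F) (h3A'R F j c' B₃ B₉ a₀ a₁' hc' hB₃ hB₉ ha₀ ha₁' h15 h9)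

/-- **NODE O's JETS-FREE PAIR AT A1's WITNESS `θ₁₅ᶜᶜᴹ(j)` SUPPLIES V20-R's 3ᴬ′ AT THE CUBE LETTER `(j, c)`** — PART 1 §4's `absBetaBoxAt_of_jetsFreePairAt` with the first antecedent
floor-carrying (`VariationalThm1RegSepCoP7MGB F 2 (floorGuard F c) (lamDatum F) Dat B₃ a₀ a₁`); N26's `exists_betaBox_betaOfRecord₁₃_of_jetsFreePair` is θ-generic, so the proof is the same three lines.
CONDITIONAL on the pair; NOT proved; no sign; nothing of Bałaban asserted.
[cite: Balaban1987RG1, Thm 2 p.259, §1 p.264, (2.12)–(2.14) p.268, (5.10) p.293; Balaban1988RG2Cluster, Lemma 3 (2.38) p.20; Balaban1985Variational, Thm 1 p.279, Prop. 8 p.304, p.304 lines 1–2] -/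
theorem absBetaBoxAtR_of_jetsFreePairAtR (F : T4Family) {Dat : TopData F 2} (j c : ℕ)
    (h : ∀ B₃ B₃' a₀ a₁ : ℝ, 2 * (F.L : ℝ) ^ 2 ≤ B₃ → 0 < B₃' → 0 < a₀ → 0 < a₁ →
      VariationalThm1RegSepCoP7MGB F 2 (floorGuard F c) (lamDatum F) Dat B₃ a₀ a₁ →
      Gauge9RegSepTopStepGB F 2 (fun ν K Ω => suppDomOfRecord F ν K Ω) (F.L ^ j) (floorGuard F c) (lamDatum F) Dat B₃ B₃' a₀ a₁ →
      ∃ ε₀ ε₂₉ : ℝ, 0 < ε₀ ∧ 0 < ε₂₉ ∧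
        (letI := (theta13OfThm1CCM F 2 j ε₀ ε₂₉ B₃ B₃' a₀ a₁).instVβ₁; letI := (theta13OfThm1CCM F 2 j ε₀ ε₂₉ B₃ B₃' a₀ a₁).instVβ₂;
         letI := (theta13OfThm1CCM F 2 j ε₀ ε₂₉ B₃ B₃' a₀ a₁).instιβ
         ∃ d A : ℝ, 0 ≤ d ∧
           OneLoopDrift d A (beta0OfMerged (betaMerged F (mergedTermFamilyMatT F 2 (TcanOfRecord F 2)
             (chiFixed29 F 2 (theta13OfThm1CCM F 2 j ε₀ ε₂₉ B₃ B₃' a₀ a₁).ν (theta13OfThm1CCM F 2 j ε₀ ε₂₉ B₃ B₃' a₀ a₁).ε₂₉) (theta13OfThm1CCM F 2 j ε₀ ε₂₉ B₃ B₃' a₀ a₁).εbg)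
             (theta13OfThm1CCM F 2 j ε₀ ε₂₉ B₃ B₃' a₀ a₁).ρ8 (theta13OfThm1CCM F 2 j ε₀ ε₂₉ B₃ B₃' a₀ a₁).bV) (theta13OfThm1CCM F 2 j ε₀ ε₂₉ B₃ B₃' a₀ a₁).v₀) ∧
           ∃ γ₀ : ℝ, 0 < γ₀ ∧ γ₀ ≤ (theta13OfThm1CCM F 2 j ε₀ ε₂₉ B₃ B₃' a₀ a₁).γ ∧
             AtSlopeCont
               (oneLoopSplit_betaOfMerged
                 (betaMerged F (mergedTermFamilyMatT F 2 (TcanOfRecord F 2)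
                   (chiFixed29 F 2 (theta13OfThm1CCM F 2 j ε₀ ε₂₉ B₃ B₃' a₀ a₁).ν (theta13OfThm1CCM F 2 j ε₀ ε₂₉ B₃ B₃' a₀ a₁).ε₂₉) (theta13OfThm1CCM F 2 j ε₀ ε₂₉ B₃ B₃' a₀ a₁).εbg)
                   (theta13OfThm1CCM F 2 j ε₀ ε₂₉ B₃ B₃' a₀ a₁).ρ8 (theta13OfThm1CCM F 2 j ε₀ ε₂₉ B₃ B₃' a₀ a₁).bV)
                 (beta0OfMerged (betaMerged F (mergedTermFamilyMatT F 2 (TcanOfRecord F 2)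
                   (chiFixed29 F 2 (theta13OfThm1CCM F 2 j ε₀ ε₂₉ B₃ B₃' a₀ a₁).ν (theta13OfThm1CCM F 2 j ε₀ ε₂₉ B₃ B₃' a₀ a₁).ε₂₉) (theta13OfThm1CCM F 2 j ε₀ ε₂₉ B₃ B₃' a₀ a₁).εbg)
                   (theta13OfThm1CCM F 2 j ε₀ ε₂₉ B₃ B₃' a₀ a₁).ρ8 (theta13OfThm1CCM F 2 j ε₀ ε₂₉ B₃ B₃' a₀ a₁).bV) (theta13OfThm1CCM F 2 j ε₀ ε₂₉ B₃ B₃' a₀ a₁).v₀)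
                 (theta13OfThm1CCM F 2 j ε₀ ε₂₉ B₃ B₃' a₀ a₁).γ)
               γ₀ d)) :
    ∀ B₃ B₃' a₀ a₁ : ℝ, 2 * (F.L : ℝ) ^ 2 ≤ B₃ → 0 < B₃' → 0 < a₀ → 0 < a₁ →
      VariationalThm1RegSepCoP7MGB F 2 (floorGuard F c) (lamDatum F) Dat B₃ a₀ a₁ →
      Gauge9RegSepTopStepGB F 2 (fun ν K Ω => suppDomOfRecord F ν K Ω) (F.L ^ j) (floorGuard F c) (lamDatum F) Dat B₃ B₃' a₀ a₁ →
      ∃ γ₀ ε₀ ε₂₉ β' : ℝ, 0 < γ₀ ∧ 0 < ε₀ ∧ 0 < ε₂₉ ∧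
        BetaLowerH (-β') γ₀ (betaOfRecord₁₃ F 2 (theta13OfThm1CCM F 2 j ε₀ ε₂₉ B₃ B₃' a₀ a₁)) ∧
        BetaUpperH β' γ₀ (betaOfRecord₁₃ F 2 (theta13OfThm1CCM F 2 j ε₀ ε₂₉ B₃ B₃' a₀ a₁)) := by
  intro B₃ B₃' a₀ a₁ hB₃ hB₃' ha₀ ha₁ h15 h9
  obtain ⟨ε₀, ε₂₉, hε, hε', hJ⟩ := h B₃ B₃' a₀ a₁ hB₃ hB₃' ha₀ ha₁ h15 h9
  obtain ⟨γ₀, hγ0, -, β', -, hup, hlow, -⟩ := exists_betaBox_betaOfRecord₁₃_of_jetsFreePair F 2 (theta13OfThm1CCM F 2 j ε₀ ε₂₉ B₃ B₃' a₀ a₁) hJ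
  exact ⟨γ₀, ε₀, ε₂₉, β', hγ0, hε, hε', hlow, hup⟩

end Part1Floor


end Summit.QuantumFields.YangMills.Theorems.K0AllTorusOfStepTokensRFloorB

end
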